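import Mathlib.Analysis.SpecialFunctions.SmoothTransition
import Mathlib.Analysis.InnerProductSpace.Calculus
import Mathlib.MeasureTheory.Constructions.HaarToSphere
import Mathlib.MeasureTheory.Measure.Lebesgue.VolumeOfBalls
import Mathlib.MeasureTheory.Integral.IntegralEqImproper
import Mathlib.Analysis.SpecialFunctions.Gamma.Basic
import HarnessLib

/-!
# The flux of a field with a radial principal part through shrinking cut-offs

Pure analysis on a `2`-dimensional real inner product space `E` (Lebesgue measure), the analytic
core of the boundary term in the Poincaré–Hopf proof of the Gauss–Bonnet theorem ("the flux of
`∇_V V − (div V) V` out of a small disc around an isolated zero of `V` of index `ι` tends to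
`2π ι`"). Everything is proved; the definitions are the explicit cut-off profile and cut-offs.

* `IndexFlux.profile` — `θ(s) = smoothTransition((s−1)/3)`: smooth, `0` on `(−∞, 1]`, `1` on
  `[4, ∞)`, `θ'` bounded and supported in `[1, 4]`;
* `IndexFlux.cutoff T c r` — `χ_r(x) = θ(‖T(x − c)‖²/r²)` for a linear map `T`: smooth, `0` near
  `c`, with `dχ_r(x) v = θ'(‖Tu‖²/r²)(2/r²)⟨Tu, Tv⟩` (`u = x − c`), `|dχ_r(x) v| ≤ 4B‖T‖‖v‖/r`,
  `dχ_r = 0` off the annulus `r ≤ ‖T(x−c)‖ ≤ 2r`;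
* `integral_deriv_profile_norm_sq` — `∫_E 2θ'(‖z‖²/r²)/r² dz = 2π` (polar coordinates:
  Mathlib's `integral_fun_norm_addHaar`, the area `π` of the unit disc, and the fundamental
  theorem of calculus on `[0, ∞)`); `integral_comp_continuousLinearEquiv` —
  `∫ F(Tx) dx = |det T|⁻¹ ∫ F`;
* `integral_fderiv_cutoff_radial` — **the principal term is exact**: for the radial field
  `X₀(x) = κ (x − c)/‖T(x − c)‖²`, `∫ dχ_r(X₀) dx = 2πκ/|det T|` for every `r > 0`;
* `abs_integral_fderiv_cutoff_sub_le` — **the flux estimate**: if on a punctured ball around `c`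
  the field `X` is continuous with `‖X − X₀‖ ≤ C_R` and the density `ρ` is continuous with
  `|ρ(x) − ρ(c)| ≤ C_ρ‖x − c‖`, then `‖∫ dχ_r(X) ρ dx − 2πκρ(c)/|det T|‖ ≤ C r` for all `r > 0`
  with `2r‖T⁻¹‖ < δ` (the error terms are `O(1/r²)·O(r)` and `O(1/r)·O(1)` on an annulus of area
  `O(r²)`).

In the application (`GaussBonnet`), `c` is a nondegenerate zero of a vector field `Y` read in a
chart, `L = DŶ(c)`, `G₀` the metric at `c` with `G₀(v, w) = ⟨Av, Aw⟩`, `T = A ∘ L`, `κ = −det L`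
(the principal part of the normalized acceleration field is `−det(L)(x−c)/G₀(L(x−c), L(x−c))`
by Cayley–Hamilton), `ρ = √det G` the Riemannian density with `ρ(c) = |det A|`, so that the limit
is `−2π det L |det A|/(|det A| |det L|) = −2π sign(det L) = −2π (−1)^{index}`.

## References

* J. M. Lee, *Introduction to Riemannian Manifolds*, 2nd ed., Springer 2018, Ch. 9 (Gauss–Bonnet;
  here an analytic replacement for the rotation index computation). [LeeRiemannianManifolds2018]
-/

noncomputable section

open Set Filter MeasureTheory Metric Real
open scoped Topology RealInnerProductSpace

namespace Literature.Geometry.Riemannian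

namespace IndexFlux

/-! ### The cut-off profile -/

/-- The **cut-off profile** `θ(s) = smoothTransition ((s − 1)/3)`: smooth, `0` for `s ≤ 1`, `1` for
`s ≥ 4`, with values in `[0, 1]`. [folklore] -/
def profile (s : ℝ) : ℝ := Real.smoothTransition ((s - 1) / 3)

/-- The profile vanishes on `(−∞, 1]`. [folklore] -/
theorem profile_of_le_one {s : ℝ} (hs : s ≤ 1) : profile s = 0 :=
  Real.smoothTransition.zero_of_nonpos (by rw [div_nonpos_iff]; right; constructor <;> linarith)

/-- The profile is `1` on `[4, ∞)`. [folklore] -/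
theorem profile_of_four_le {s : ℝ} (hs : 4 ≤ s) : profile s = 1 :=
  Real.smoothTransition.one_of_one_le (by rw [le_div_iff₀ (by norm_num : (0:ℝ) < 3)]; linarith)

/-- The profile is smooth. [folklore] -/
theorem contDiff_profile {n : ℕ∞} : ContDiff ℝ n profile :=
  Real.smoothTransition.contDiff.comp ((contDiff_id.sub contDiff_const).div_const _)

/-- The profile is nonnegative. [folklore] -/
theorem profile_nonneg (s : ℝ) : 0 ≤ profile s := Real.smoothTransition.nonneg _

/-- The profile is at most `1`. [folklore] -/
theorem profile_le_one (s : ℝ) : profile s ≤ 1 := Real.smoothTransition.le_one _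

/-- The profile is differentiable. [folklore] -/
theorem differentiable_profile : Differentiable ℝ profile :=
  (contDiff_profile (n := 1)).differentiable one_ne_zero

/-- The derivative of the profile is continuous. [folklore] -/
theorem continuous_deriv_profile : Continuous (deriv profile) :=
  (contDiff_profile (n := 1)).continuous_deriv le_rfl

/-- The derivative of the profile vanishes off `[1, 4]`. [folklore] -/
theorem deriv_profile_eq_zero {s : ℝ} (hs : s < 1 ∨ 4 < s) : deriv profile s = 0 := by
  rcases hs with hs | hs
  · have h : profile =ᶠ[𝓝 s] fun _ ↦ (0 : ℝ) := by
      filter_upwards [Iio_mem_nhds hs] with t ht using profile_of_le_one ht.le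
    rw [h.deriv_eq, deriv_const]
  · have h : profile =ᶠ[𝓝 s] fun _ ↦ (1 : ℝ) := by
      filter_upwards [Ioi_mem_nhds hs] with t ht using profile_of_four_le ht.le
    rw [h.deriv_eq, deriv_const]

/-- The derivative of the profile is bounded. [folklore] -/
theorem exists_bound_deriv_profile : ∃ B : ℝ, 0 ≤ B ∧ ∀ s, |deriv profile s| ≤ B := by
  obtain ⟨B, hB⟩ := (isCompact_Icc (a := (1:ℝ)) (b := 4)).exists_bound_of_continuousOn
    continuous_deriv_profile.continuousOn
  refine ⟨max B 0, le_max_right _ _, fun s ↦ ?_⟩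
  by_cases hs : s ∈ Icc (1:ℝ) 4
  · exact (Real.norm_eq_abs _ ▸ hB s hs).trans (le_max_left _ _)
  · rw [mem_Icc, not_and_or, not_le, not_le] at hs
    rw [deriv_profile_eq_zero hs, abs_zero]
    exact le_max_right _ _

/-! ### The radial integral `∫ 2 θ'(‖z‖²/r²)/r² dz = 2π` in the plane -/

variable {E : Type*} [NormedAddCommGroup E] [InnerProductSpace ℝ E]

section Radial

variable [FiniteDimensional ℝ E] [MeasurableSpace E] [BorelSpace E]

omit [FiniteDimensional ℝ E] [MeasurableSpace E] [BorelSpace E] in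
/-- The one-dimensional integral behind the radial one: `∫₀^∞ θ'(y²/r²) (2y/r²) dy = 1`
(the fundamental theorem of calculus for `y ↦ θ(y²/r²)` on `[0, ∞)`). [folklore] -/
theorem integral_Ioi_deriv_profile_comp {r : ℝ} (hr : 0 < r) :
    ∫ y in Ioi (0:ℝ), deriv profile (y ^ 2 / r ^ 2) * (2 * y / r ^ 2) = 1 := by
  have hderiv : ∀ y ∈ Ioi (0:ℝ), HasDerivAt (fun y ↦ profile (y ^ 2 / r ^ 2))
      (deriv profile (y ^ 2 / r ^ 2) * (2 * y / r ^ 2)) y := by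
    intro y _
    have h1 : HasDerivAt (fun y : ℝ ↦ y ^ 2 / r ^ 2) (2 * y / r ^ 2) y := by
      simpa using ((hasDerivAt_pow 2 y).div_const (r ^ 2))
    exact (differentiable_profile _).hasDerivAt.comp y h1
  have hcont : ContinuousWithinAt (fun y ↦ profile (y ^ 2 / r ^ 2)) (Ici 0) 0 :=
    (contDiff_profile (n := 0)).continuous.continuousAt.comp_continuousWithinAt
      ((continuous_pow 2).div_const _).continuousWithinAt
  -- the derivative is continuous with support in `[0, 2r]`, hence integrable
  have hint : IntegrableOn (fun y ↦ deriv profile (y ^ 2 / r ^ 2) * (2 * y / r ^ 2)) (Ioi 0) := by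
    have hc : Continuous (fun y ↦ deriv profile (y ^ 2 / r ^ 2) * (2 * y / r ^ 2)) :=
      (continuous_deriv_profile.comp ((continuous_pow 2).div_const _)).mul
        ((continuous_const.mul continuous_id).div_const _)
    refine IntegrableOn.of_forall_sdiff_eq_zero (hc.integrableOn_Icc (a := 0) (b := 2 * r))
      measurableSet_Ioi fun y hy ↦ ?_
    simp only [Set.mem_sdiff, mem_Ioi, mem_Icc, not_and, not_le] at hy
    have hy2 : 2 * r < y := hy.2 hy.1.le
    have : 4 < y ^ 2 / r ^ 2 := by
      rw [lt_div_iff₀ (by positivity)]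
      nlinarith
    rw [deriv_profile_eq_zero (Or.inr this), zero_mul]
  have hlim : Tendsto (fun y ↦ profile (y ^ 2 / r ^ 2)) atTop (𝓝 1) := by
    refine tendsto_const_nhds.congr' ?_
    filter_upwards [eventually_ge_atTop (2 * r)] with y hy
    refine (profile_of_four_le ?_).symm
    rw [le_div_iff₀ (by positivity)]
    nlinarith
  rw [integral_Ioi_of_hasDerivAt_of_tendsto hcont hderiv hint hlim]
  simp [profile_of_le_one]

/-- **The radial integral**: on a `2`-dimensional inner product space,
`∫ 2 θ'(‖z‖²/r²)/r² dz = 2π` (polar coordinates, `integral_fun_norm_addHaar`, the area `π` of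
the unit disc, and `integral_Ioi_deriv_profile_comp`). [folklore] -/
theorem integral_deriv_profile_norm_sq (h2 : Module.finrank ℝ E = 2) {r : ℝ} (hr : 0 < r) :
    ∫ z : E, deriv profile (‖z‖ ^ 2 / r ^ 2) * (2 / r ^ 2) = 2 * π := by
  haveI : Nontrivial E := Module.nontrivial_of_finrank_pos (R := ℝ) (by omega)
  have h := MeasureTheory.integral_fun_norm_addHaar (volume : Measure E)
    (fun y ↦ deriv profile (y ^ 2 / r ^ 2) * (2 / r ^ 2))
  rw [h, h2]
  have hball : (volume : Measure E).real (ball 0 1) = π := by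
    rw [Measure.real, InnerProductSpace.volume_ball, h2]
    simp only [ENNReal.ofReal_one, one_pow, one_mul, Nat.cast_ofNat]
    rw [ENNReal.toReal_ofReal (by positivity)]
    norm_num [Real.sq_sqrt Real.pi_pos.le]
  rw [hball]
  have hI : ∫ y in Ioi (0:ℝ), y ^ (2 - 1) • (deriv profile (y ^ 2 / r ^ 2) * (2 / r ^ 2)) = 1 := by
    rw [← integral_Ioi_deriv_profile_comp hr]
    refine setIntegral_congr_fun measurableSet_Ioi fun y _ ↦ ?_
    simp only [show 2 - 1 = 1 from rfl, pow_one, smul_eq_mul]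
    ring
  rw [hI]
  simp

/-! ### Change of variables by an invertible linear map -/

/-- **Linear change of variables**: `∫ F(T x) dx = |det T|⁻¹ ∫ F(y) dy` for a continuous linear
automorphism `T` (Mathlib's `map_linearMap_addHaar_eq_smul_addHaar`). [folklore] -/
theorem integral_comp_continuousLinearEquiv (T : E ≃L[ℝ] E) (F : E → ℝ) :
    ∫ x, F (T x) = |LinearMap.det (T : E →ₗ[ℝ] E)|⁻¹ * ∫ y, F y := by
  have hdet : LinearMap.det (T : E →ₗ[ℝ] E) ≠ 0 :=
    (LinearEquiv.isUnit_det' T.toLinearEquiv).ne_zero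
  have hmap : Measure.map (T : E → E) volume =
      ENNReal.ofReal |(LinearMap.det (T : E →ₗ[ℝ] E))⁻¹| • (volume : Measure E) :=
    Measure.map_linearMap_addHaar_eq_smul_addHaar volume hdet
  have hme : MeasurableEmbedding (T : E → E) := T.toHomeomorph.measurableEmbedding
  rw [← hme.integral_map, hmap, integral_smul_measure, ENNReal.toReal_ofReal (abs_nonneg _),
    abs_inv, smul_eq_mul]

end Radial

/-! ### The cut-offs `χ_r(x) = θ(‖T(x − c)‖²/r²)` -/

/-- The **cut-off of radius `r` centred at `c`, radial for the norm `‖T ·‖`**: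
`χ_r(x) = θ(‖T(x − c)‖²/r²)`; it vanishes where `‖T(x−c)‖ ≤ r` and equals `1` where
`‖T(x−c)‖ ≥ 2r`. [folklore] -/
def cutoff (T : E →L[ℝ] E) (c : E) (r : ℝ) (x : E) : ℝ :=
  profile (‖T (x - c)‖ ^ 2 / r ^ 2)

/-- Unfolding lemma for `cutoff`. [folklore] -/
theorem cutoff_apply (T : E →L[ℝ] E) (c : E) (r : ℝ) (x : E) :
    cutoff T c r x = profile (‖T (x - c)‖ ^ 2 / r ^ 2) := rfl

/-- The derivative of the cut-off: `dχ_r(x) v = θ'(‖Tu‖²/r²) (2/r²) ⟨Tu, Tv⟩`, `u = x − c`.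
[folklore] -/
theorem hasFDerivAt_cutoff (T : E →L[ℝ] E) (c : E) (r : ℝ) (x : E) :
    HasFDerivAt (cutoff T c r)
      ((deriv profile (‖T (x - c)‖ ^ 2 / r ^ 2) * (2 / r ^ 2)) •
        (innerSL ℝ (T (x - c))).comp T) x := by
  have hT : HasFDerivAt (fun y : E ↦ T (y - c)) (T.comp (ContinuousLinearMap.id ℝ E)) x :=
    T.hasFDerivAt.comp x ((hasFDerivAt_id x).sub_const c)
  rw [ContinuousLinearMap.comp_id] at hT
  have hq : HasFDerivAt (fun y : E ↦ ‖T (y - c)‖ ^ 2 / r ^ 2)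
      ((r ^ 2)⁻¹ • ((2 : ℕ) • (innerSL ℝ (T (x - c))).comp T)) x :=
    hT.norm_sq.mul_const _
  have hp : HasDerivAt profile (deriv profile (‖T (x - c)‖ ^ 2 / r ^ 2))
      (‖T (x - c)‖ ^ 2 / r ^ 2) := (differentiable_profile _).hasDerivAt
  have h := hp.comp_hasFDerivAt x hq
  refine h.congr_fderiv ?_
  ext v
  simp only [_root_.smul_apply, ContinuousLinearMap.comp_apply, innerSL_apply_apply,
    smul_eq_mul, nsmul_eq_mul, Nat.cast_ofNat]
  ring

/-- `fderiv` form of `hasFDerivAt_cutoff`. [folklore] -/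
theorem fderiv_cutoff_apply (T : E →L[ℝ] E) (c : E) (r : ℝ) (x v : E) :
    fderiv ℝ (cutoff T c r) x v =
      deriv profile (‖T (x - c)‖ ^ 2 / r ^ 2) * (2 / r ^ 2) * ⟪T (x - c), T v⟫ := by
  rw [(hasFDerivAt_cutoff T c r x).fderiv]
  simp only [_root_.smul_apply, ContinuousLinearMap.comp_apply, innerSL_apply_apply,
    smul_eq_mul]

/-- The cut-offs are differentiable. [folklore] -/
theorem differentiable_cutoff (T : E →L[ℝ] E) (c : E) (r : ℝ) : Differentiable ℝ (cutoff T c r) :=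
  fun x ↦ (hasFDerivAt_cutoff T c r x).differentiableAt

/-- The cut-offs are smooth. [folklore] -/
theorem contDiff_cutoff (T : E →L[ℝ] E) (c : E) (r : ℝ) {n : ℕ∞} : ContDiff ℝ n (cutoff T c r) := by
  unfold cutoff
  exact contDiff_profile.comp (((T.contDiff.comp (contDiff_id.sub contDiff_const)).norm_sq ℝ).div_const _)

/-- The derivative of a cut-off is continuous. [folklore] -/
theorem continuous_fderiv_cutoff (T : E →L[ℝ] E) (c : E) (r : ℝ) :
    Continuous (fderiv ℝ (cutoff T c r)) :=
  (contDiff_cutoff T c r (n := 1)).continuous_fderiv one_ne_zero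

/-- The derivative of the cut-off vanishes off the annulus `r² ≤ ‖T(x−c)‖² ≤ 4r²`. [folklore] -/
theorem fderiv_cutoff_eq_zero {T : E →L[ℝ] E} {c : E} {r : ℝ} {x : E}
    (hx : ‖T (x - c)‖ ^ 2 / r ^ 2 < 1 ∨ 4 < ‖T (x - c)‖ ^ 2 / r ^ 2) :
    fderiv ℝ (cutoff T c r) x = 0 := by
  rw [(hasFDerivAt_cutoff T c r x).fderiv, deriv_profile_eq_zero hx, zero_mul, zero_smul]

/-- The cut-off vanishes identically near the centre (for `r > 0`). [folklore] -/
theorem cutoff_eventuallyEq_zero (T : E →L[ℝ] E) (c : E) (r : ℝ) :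
    cutoff T c r =ᶠ[𝓝 c] fun _ ↦ 0 := by
  have hc : ContinuousAt (fun x : E ↦ ‖T (x - c)‖ ^ 2 / r ^ 2) c :=
    (((T.continuous.comp (continuous_id.sub continuous_const)).norm.pow 2).div_const _).continuousAt
  have h0 : (fun x : E ↦ ‖T (x - c)‖ ^ 2 / r ^ 2) c < 1 := by simp
  filter_upwards [hc.eventually (Iio_mem_nhds h0)] with x hx
  exact profile_of_le_one (le_of_lt hx)

/-- **Bound on the derivative of the cut-off**: `|dχ_r(x) v| ≤ 4 B ‖T‖ ‖v‖ / r` everywhere, `B`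
a bound for `θ'`. [folklore] -/
theorem abs_fderiv_cutoff_le {T : E →L[ℝ] E} {c : E} {r : ℝ} (hr : 0 < r) {B : ℝ} (hB0 : 0 ≤ B)
    (hB : ∀ s, |deriv profile s| ≤ B) (x v : E) :
    |fderiv ℝ (cutoff T c r) x v| ≤ 4 * B * ‖T‖ * ‖v‖ / r := by
  by_cases hx : ‖T (x - c)‖ ^ 2 / r ^ 2 ≤ 4
  · rw [fderiv_cutoff_apply]
    have hTu : ‖T (x - c)‖ ≤ 2 * r := by
      rw [div_le_iff₀ (by positivity)] at hx
      nlinarith [norm_nonneg (T (x - c))]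
    calc |deriv profile (‖T (x - c)‖ ^ 2 / r ^ 2) * (2 / r ^ 2) * ⟪T (x - c), T v⟫|
        = |deriv profile (‖T (x - c)‖ ^ 2 / r ^ 2)| * (2 / r ^ 2) * |⟪T (x - c), T v⟫| := by
          rw [abs_mul, abs_mul, abs_of_pos (by positivity : (0:ℝ) < 2 / r ^ 2)]
      _ ≤ B * (2 / r ^ 2) * (‖T (x - c)‖ * ‖T v‖) := by
          gcongr
          · exact hB _
          · exact abs_real_inner_le_norm _ _
      _ ≤ B * (2 / r ^ 2) * ((2 * r) * (‖T‖ * ‖v‖)) := by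
          gcongr
          exact T.le_opNorm v
      _ = 4 * B * ‖T‖ * ‖v‖ / r := by
          field_simp
          ring
  · rw [fderiv_cutoff_eq_zero (Or.inr (lt_of_not_ge hx)), _root_.zero_apply, abs_zero]
    positivity

/-- **The derivative of the cut-off on the radial field**: for `u = x − c` with `Tu ≠ 0`,
`dχ_r(x) (κ u/‖Tu‖²) = κ θ'(‖Tu‖²/r²) (2/r²)`. [folklore] -/
theorem fderiv_cutoff_radial (T : E →L[ℝ] E) (c : E) (r κ : ℝ) {x : E} (hx : T (x - c) ≠ 0) :
    fderiv ℝ (cutoff T c r) x ((κ / ‖T (x - c)‖ ^ 2) • (x - c)) =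
      κ * (deriv profile (‖T (x - c)‖ ^ 2 / r ^ 2) * (2 / r ^ 2)) := by
  rw [fderiv_cutoff_apply, map_smul, real_inner_smul_right, real_inner_self_eq_norm_sq]
  have : ‖T (x - c)‖ ^ 2 ≠ 0 := pow_ne_zero 2 (norm_ne_zero_iff.2 hx)
  field_simp

/-- On the support of `dχ_r`, `r ≤ ‖T(x − c)‖ ≤ 2r`; in particular `‖x − c‖ ≤ 2 r ‖T⁻¹‖` for
`T` invertible. [folklore] -/
theorem norm_le_of_fderiv_cutoff_ne_zero {T : E →L[ℝ] E} {c : E} {r : ℝ} (hr : 0 < r) {x : E}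
    (hx : fderiv ℝ (cutoff T c r) x ≠ 0) : r ≤ ‖T (x - c)‖ ∧ ‖T (x - c)‖ ≤ 2 * r := by
  by_contra h
  apply hx
  apply fderiv_cutoff_eq_zero
  rw [not_and_or, not_le, not_le] at h
  rcases h with h | h
  · left
    rw [div_lt_one (by positivity)]
    have := norm_nonneg (T (x - c))
    nlinarith
  · right
    rw [lt_div_iff₀ (by positivity)]
    nlinarith

/-! ### The flux of a field with a radial principal part through the shrinking cut-offs -/

section Flux

variable [FiniteDimensional ℝ E] [MeasurableSpace E] [BorelSpace E]

omit [FiniteDimensional ℝ E] [MeasurableSpace E] [BorelSpace E] in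
/-- `dχ_r(x)` applied to the radial field `κ (x−c)/‖T(x−c)‖²` is `κ θ'(‖T(x−c)‖²/r²)(2/r²)` at
every point (both sides vanish at `x = c`). [folklore] -/
theorem fderiv_cutoff_radial' (T : E ≃L[ℝ] E) (c : E) (r : ℝ) (κ : ℝ) (x : E) :
    fderiv ℝ (cutoff (T : E →L[ℝ] E) c r) x ((κ / ‖T (x - c)‖ ^ 2) • (x - c)) =
      κ * (deriv profile (‖T (x - c)‖ ^ 2 / r ^ 2) * (2 / r ^ 2)) := by
  by_cases hx : x = c
  · subst hx
    have h0 : deriv profile 0 = 0 := deriv_profile_eq_zero (Or.inl (by norm_num))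
    simp [h0]
  · have hT : (T : E →L[ℝ] E) (x - c) ≠ 0 := fun h ↦
      hx (sub_eq_zero.1 (T.injective (by rw [map_zero]; exact h)))
    exact fderiv_cutoff_radial (T : E →L[ℝ] E) c r κ hT

/-- **The principal term is exact**: `∫ dχ_r(x)(κ (x−c)/‖T(x−c)‖²) dx = 2π κ/|det T|` on a plane,
for every `r > 0` (translation, the linear change of variables `z = T(x − c)`, and the radial
integral `integral_deriv_profile_norm_sq`). [folklore] -/
theorem integral_fderiv_cutoff_radial (h2 : Module.finrank ℝ E = 2) (T : E ≃L[ℝ] E) (c : E)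
    {r : ℝ} (hr : 0 < r) (κ : ℝ) :
    ∫ x, fderiv ℝ (cutoff (T : E →L[ℝ] E) c r) x ((κ / ‖T (x - c)‖ ^ 2) • (x - c)) =
      2 * π * κ / |LinearMap.det (T : E →ₗ[ℝ] E)| := by
  simp_rw [fderiv_cutoff_radial' T c r κ]
  rw [integral_const_mul]
  have h := integral_sub_right_eq_self (μ := (volume : Measure E))
    (fun u : E ↦ deriv profile (‖T u‖ ^ 2 / r ^ 2) * (2 / r ^ 2)) c
  have h3 := integral_comp_continuousLinearEquiv T
    (fun z : E ↦ deriv profile (‖z‖ ^ 2 / r ^ 2) * (2 / r ^ 2))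
  rw [h, h3, integral_deriv_profile_norm_sq h2 hr]
  ring

/-- The real volume of a disc in the plane. [folklore] -/
theorem volume_real_closedBall_of_finrank_eq_two (h2 : Module.finrank ℝ E = 2) (c : E) {s : ℝ}
    (hs : 0 ≤ s) : (volume : Measure E).real (closedBall c s) = π * s ^ 2 := by
  haveI : Nontrivial E := Module.nontrivial_of_finrank_pos (R := ℝ) (by omega)
  rw [Measure.real, InnerProductSpace.volume_closedBall, h2]
  rw [ENNReal.toReal_mul, ← ENNReal.ofReal_pow hs, ENNReal.toReal_ofReal (by positivity),
    ENNReal.toReal_ofReal (by positivity)]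
  norm_num [Real.sq_sqrt Real.pi_pos.le]
  ring

/-- **Flux of a field with a radial principal part through shrinking cut-offs.** In a plane `E`
let `T` be a linear automorphism, `c` a point, `κ ∈ ℝ`, and on a punctured ball around `c` let
`X` be a continuous field with `‖X(x) − κ (x−c)/‖T(x−c)‖²‖ ≤ C_R` (bounded remainder after the
radial principal part) and `ρ` a continuous density with `|ρ(x) − ρ(c)| ≤ C_ρ ‖x − c‖`. Then for
the cut-offs `χ_r(x) = θ(‖T(x−c)‖²/r²)`,
`‖∫ dχ_r(X) ρ dx − 2π κ ρ(c)/|det T|‖ ≤ C r` for all small `r > 0`: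
the principal part contributes exactly `2π κ ρ(c)/|det T|` (`integral_fderiv_cutoff_radial`),
and the two error terms are `O(1/r) · O(r) · O(r²)/r… = O(r)` on the annulus
`r ≤ ‖T(x−c)‖ ≤ 2r` of area `O(r²)` where `dχ_r = O(1/r)`. This is the analytic core of
"the boundary term at an isolated zero of index `ι` is `2π ι`" in the Poincaré–Hopf proof of the
Gauss–Bonnet theorem. [folklore] -/
theorem abs_integral_fderiv_cutoff_sub_le (h2 : Module.finrank ℝ E = 2) (T : E ≃L[ℝ] E) (c : E)
    (κ : ℝ) {X : E → E} {ρ : E → ℝ} {δ CR Cρ : ℝ}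
    (hXc : ContinuousOn X (ball c δ \ {c})) (hρc : ContinuousOn ρ (ball c δ))
    (hR : ∀ x ∈ ball c δ \ {c}, ‖X x - (κ / ‖T (x - c)‖ ^ 2) • (x - c)‖ ≤ CR)
    (hρL : ∀ x ∈ ball c δ, |ρ x - ρ c| ≤ Cρ * ‖x - c‖) :
    ∃ C : ℝ, ∀ r : ℝ, 0 < r → 2 * r * ‖(T.symm : E →L[ℝ] E)‖ < δ →
      ‖(∫ x, fderiv ℝ (cutoff (T : E →L[ℝ] E) c r) x (X x) * ρ x) -
        2 * π * κ * ρ c / |LinearMap.det (T : E →ₗ[ℝ] E)|‖ ≤ C * r := by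
  obtain ⟨B, hB0, hB⟩ := exists_bound_deriv_profile
  set N : ℝ := ‖(T.symm : E →L[ℝ] E)‖ with hN
  set NT : ℝ := ‖(T : E →L[ℝ] E)‖ with hNT
  set CR' : ℝ := max CR 0 with hCR'
  set Cρ' : ℝ := max Cρ 0 with hCρ'
  set M : ℝ := 4 * |κ| * B * Cρ' * N + 4 * B * NT * CR' * (|ρ c| + Cρ' * |δ|) with hM
  have hM0 : 0 ≤ M := by positivity
  refine ⟨M * (4 * π * N ^ 2), fun r hr hrδ ↦ ?_⟩
  -- notation
  set D := fderiv ℝ (cutoff (T : E →L[ℝ] E) c r) with hD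
  set X₀ : E → E := fun x ↦ (κ / ‖T (x - c)‖ ^ 2) • (x - c) with hX₀
  set K : Set E := closedBall c (2 * r * N) with hK
  -- where `dχ_r ≠ 0`
  have hsupp : ∀ x, D x ≠ 0 → x ∈ K ∧ x ∈ ball c δ ∧ x ≠ c ∧ r ≤ ‖T (x - c)‖ ∧
      ‖T (x - c)‖ ≤ 2 * r := by
    intro x hx
    obtain ⟨h1, h2'⟩ := norm_le_of_fderiv_cutoff_ne_zero hr hx
    have hxc : ‖x - c‖ ≤ 2 * r * N := by
      calc ‖x - c‖ = ‖(T.symm : E →L[ℝ] E) (T (x - c))‖ := by simp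
        _ ≤ N * ‖T (x - c)‖ := (T.symm : E →L[ℝ] E).le_opNorm _
        _ ≤ N * (2 * r) := by gcongr; exact h2'
        _ = 2 * r * N := by ring
    refine ⟨mem_closedBall_iff_norm.2 hxc, mem_ball_iff_norm.2 (hxc.trans_lt hrδ), ?_, h1, h2'⟩
    rintro rfl
    simp only [sub_self, map_zero, norm_zero] at h1
    linarith
  have hzero : ∀ x, x ∉ K → D x = 0 := fun x hx ↦ by
    by_contra h
    exact hx (hsupp x h).1
  -- the principal part: `D x (X₀ x) = κ θ'(q x) (2/r²)`, continuous, integral `2πκ/|det T|`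
  have hP : ∀ x, D x (X₀ x) = κ * (deriv profile (‖T (x - c)‖ ^ 2 / r ^ 2) * (2 / r ^ 2)) :=
    fun x ↦ fderiv_cutoff_radial' T c r κ x
  have hPc : Continuous fun x ↦ D x (X₀ x) * ρ c := by
    simp_rw [hP]
    exact ((continuous_const.mul ((continuous_deriv_profile.comp
      ((((T : E →L[ℝ] E).continuous.comp (continuous_id.sub continuous_const)).norm.pow 2).div_const
        _)).mul continuous_const))).mul continuous_const
  have hPint : ∫ x, D x (X₀ x) * ρ c = 2 * π * κ * ρ c / |LinearMap.det (T : E →ₗ[ℝ] E)| := by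
    rw [integral_mul_const, integral_fderiv_cutoff_radial h2 T c hr κ]
    ring
  -- continuity of the full integrand: it is `0` near the complement of the annulus and a
  -- product of continuous functions on the punctured ball
  have hfc : Continuous fun x ↦ D x (X x) * ρ x := by
    rw [continuous_iff_continuousAt]
    intro x
    by_cases hq : ‖T (x - c)‖ ^ 2 / r ^ 2 < 1 ∨ 4 < ‖T (x - c)‖ ^ 2 / r ^ 2
    · -- locally zero
      have hqc : Continuous fun y : E ↦ ‖T (y - c)‖ ^ 2 / r ^ 2 :=
        (((T : E →L[ℝ] E).continuous.comp (continuous_id.sub continuous_const)).norm.pow 2).div_const _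
      have hev : ∀ᶠ y in 𝓝 x, ‖T (y - c)‖ ^ 2 / r ^ 2 < 1 ∨ 4 < ‖T (y - c)‖ ^ 2 / r ^ 2 := by
        rcases hq with hq | hq
        · exact (hqc.continuousAt.eventually (Iio_mem_nhds hq)).mono fun y hy ↦ Or.inl hy
        · exact (hqc.continuousAt.eventually (Ioi_mem_nhds hq)).mono fun y hy ↦ Or.inr hy
      refine continuousAt_const.congr (f := fun _ ↦ (0 : ℝ)) ?_
      filter_upwards [hev] with y hy
      rw [hD, fderiv_cutoff_eq_zero hy, _root_.zero_apply, zero_mul]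
    · -- in the punctured ball
      rw [not_or, not_lt, not_lt] at hq
      have hr1 : r ≤ ‖T (x - c)‖ := by
        have := hq.1
        rw [le_div_iff₀ (by positivity)] at this
        nlinarith [norm_nonneg (T (x - c))]
      have hr2 : ‖T (x - c)‖ ≤ 2 * r := by
        have := hq.2
        rw [div_le_iff₀ (by positivity)] at this
        nlinarith [norm_nonneg (T (x - c))]
      have hxc : ‖x - c‖ ≤ 2 * r * N := by
        calc ‖x - c‖ = ‖(T.symm : E →L[ℝ] E) (T (x - c))‖ := by simp
          _ ≤ N * ‖T (x - c)‖ := (T.symm : E →L[ℝ] E).le_opNorm _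
          _ ≤ N * (2 * r) := by gcongr
          _ = 2 * r * N := by ring
      have hxball : x ∈ ball c δ := mem_ball_iff_norm.2 (hxc.trans_lt hrδ)
      have hxne : x ≠ c := by
        rintro rfl
        simp only [sub_self, map_zero, norm_zero] at hr1
        linarith
      have hU : ball c δ \ {c} ∈ 𝓝 x :=
        (isOpen_ball.sdiff isClosed_singleton).mem_nhds ⟨hxball, hxne⟩
      have h1 : ContinuousOn (fun y ↦ D y (X y)) (ball c δ \ {c}) :=
        (continuous_fderiv_cutoff (T : E →L[ℝ] E) c r).continuousOn.clm_apply hXc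
      exact ((h1.mul (hρc.mono sdiff_subset)).continuousAt hU)
  have hfsupp : HasCompactSupport fun x ↦ D x (X x) * ρ x := by
    refine HasCompactSupport.intro (isCompact_closedBall c (2 * r * N)) fun x hx ↦ ?_
    simp only [hzero x hx, _root_.zero_apply, zero_mul]
  have hPsupp : HasCompactSupport fun x ↦ D x (X₀ x) * ρ c := by
    refine HasCompactSupport.intro (isCompact_closedBall c (2 * r * N)) fun x hx ↦ ?_
    simp only [hzero x hx, _root_.zero_apply, zero_mul]
  have hfi : Integrable (fun x ↦ D x (X x) * ρ x) := hfc.integrable_of_hasCompactSupport hfsupp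
  have hPi : Integrable (fun x ↦ D x (X₀ x) * ρ c) := hPc.integrable_of_hasCompactSupport hPsupp
  -- the error term
  set g : E → ℝ := fun x ↦ D x (X x) * ρ x - D x (X₀ x) * ρ c with hg
  have hgi : Integrable g := hfi.sub hPi
  have hg0 : ∀ x, x ∉ K → g x = 0 := fun x hx ↦ by
    simp only [hg, hzero x hx, _root_.zero_apply, zero_mul, sub_self]
  have hgb : ∀ x ∈ K, ‖g x‖ ≤ M / r := by
    intro x _
    by_cases hDx : D x = 0
    · simp only [hg, hDx, _root_.zero_apply, zero_mul, sub_self, norm_zero]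
      positivity
    obtain ⟨-, hxball, hxne, hr1, hr2⟩ := hsupp x hDx
    have hxc : ‖x - c‖ ≤ 2 * r * N := by
      calc ‖x - c‖ = ‖(T.symm : E →L[ℝ] E) (T (x - c))‖ := by simp
        _ ≤ N * ‖T (x - c)‖ := (T.symm : E →L[ℝ] E).le_opNorm _
        _ ≤ N * (2 * r) := by gcongr
        _ = 2 * r * N := by ring
    have hxδ : ‖x - c‖ ≤ |δ| := (mem_ball_iff_norm.1 hxball).le.trans (le_abs_self δ)
    -- the pieces
    have hRx : ‖X x - X₀ x‖ ≤ CR' := (hR x ⟨hxball, hxne⟩).trans (le_max_left _ _)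
    have hρx : |ρ x - ρ c| ≤ Cρ' * ‖x - c‖ :=
      (hρL x hxball).trans (mul_le_mul_of_nonneg_right (le_max_left _ _) (norm_nonneg _))
    have hρx' : |ρ x| ≤ |ρ c| + Cρ' * |δ| := by
      calc |ρ x| = |ρ c + (ρ x - ρ c)| := by ring_nf
        _ ≤ |ρ c| + |ρ x - ρ c| := abs_add_le _ _
        _ ≤ |ρ c| + Cρ' * ‖x - c‖ := by linarith
        _ ≤ |ρ c| + Cρ' * |δ| := by gcongr
    have hDX₀ : |D x (X₀ x)| ≤ 2 * |κ| * B / r ^ 2 := by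
      rw [hP x, abs_mul, abs_mul, abs_of_pos (by positivity : (0:ℝ) < 2 / r ^ 2)]
      calc |κ| * (|deriv profile (‖T (x - c)‖ ^ 2 / r ^ 2)| * (2 / r ^ 2))
          ≤ |κ| * (B * (2 / r ^ 2)) := by gcongr; exact hB _
        _ = 2 * |κ| * B / r ^ 2 := by ring
    have hDR : |D x (X x - X₀ x)| ≤ 4 * B * NT * CR' / r := by
      calc |D x (X x - X₀ x)| ≤ 4 * B * NT * ‖X x - X₀ x‖ / r :=
            abs_fderiv_cutoff_le hr hB0 hB x _
        _ ≤ 4 * B * NT * CR' / r := by gcongr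
    -- assemble
    have hgx : g x = D x (X₀ x) * (ρ x - ρ c) + D x (X x - X₀ x) * ρ x := by
      simp only [hg, map_sub]
      ring
    rw [Real.norm_eq_abs, hgx]
    calc |D x (X₀ x) * (ρ x - ρ c) + D x (X x - X₀ x) * ρ x|
        ≤ |D x (X₀ x)| * |ρ x - ρ c| + |D x (X x - X₀ x)| * |ρ x| := by
          rw [← abs_mul, ← abs_mul]; exact abs_add_le _ _
      _ ≤ (2 * |κ| * B / r ^ 2) * (Cρ' * (2 * r * N)) +
          (4 * B * NT * CR' / r) * (|ρ c| + Cρ' * |δ|) := by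
          gcongr
          · exact hρx.trans (by gcongr)
      _ = M / r := by
          rw [hM]
          field_simp
          ring
  -- the estimate
  have hgK : ∫ x, g x = ∫ x in K, g x :=
    (setIntegral_eq_integral_of_forall_compl_eq_zero fun x hx ↦ hg0 x hx).symm
  have hKvol : (volume : Measure E).real K = π * (2 * r * N) ^ 2 :=
    volume_real_closedBall_of_finrank_eq_two h2 c (by positivity)
  have hKfin : volume K < ⊤ := measure_closedBall_lt_top
  have hbound : ‖∫ x in K, g x‖ ≤ M / r * (volume : Measure E).real K :=
    norm_setIntegral_le_of_norm_le_const hKfin hgb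
  have hsplit : (∫ x, D x (X x) * ρ x) - 2 * π * κ * ρ c / |LinearMap.det (T : E →ₗ[ℝ] E)| =
      ∫ x, g x := by
    rw [← hPint, ← integral_sub hfi hPi]
  rw [hsplit, hgK]
  calc ‖∫ x in K, g x‖ ≤ M / r * (volume : Measure E).real K := hbound
    _ = M * (4 * π * N ^ 2) * r := by
        rw [hKvol]
        field_simp
        ring

end Flux

end IndexFlux

end Literature.Geometry.Riemannian

end
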